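import Summits.MatrixMultiplication.OmegaCensus.ThreeSetLineFarkasFast
import HarnessLib

/-!
# Packed dual certificates read from ONE numeral (certificate tables for large windows)

ω-census `pub-omega`, family (b3), seat pub-omega-group gen 40.  Framing: lottery ticket; floor = certified bounds/negative
ranges.  VALUE: a kernel TOOL (front-end of `ThreeSetLineFarkasFast`) for the three-set cube cells over `A ↠ ℤ_p²`; NOT
progress on ω.

`chunkChkG` (`ThreeSetLineFarkasFast`) takes the certificates of a window of `X`-data as a LIST literal; the elaborator's work
on that literal grows with the window (≈ 400 data exhaust the default heartbeat budget at `q = 31`, although the kernel needs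
only ≈ 0.06 s per datum), while every window pays for the construction of the prefix of `compsLit q d` before it.  Here the
certificates of a whole window are TWO numerals: a data numeral `N` (records `m + 2^mb · enc_m z`, concatenated bitwise) and an
index numeral `I` (per slot: `offset + 2^ob · length`, fixed width `ob + lb` bits; `slots` slots per datum, empty slots have
length `0`).  `certsOfN` cuts the records out with shifts; `chunkChkN q K X W Fs slots ob lb mb I N = chunkChkG q K X W Fs (…)`
and **`chunkChkN_sound`** is `chunkChkG_sound` (decoding is irrelevant to soundness: any decoded pairs are dual-vector
candidates, checked by `farkasChkG`).
-/

namespace Summit.MatrixMultiplication.OmegaCensus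

namespace LineInv

/-- Bits `[o, o + len)` of `N`. [folklore] -/
def bitsN (N o len : ℕ) : ℕ := (N >>> o) % 2 ^ len

/-- The certificates of datum `i` from the index numeral `I` and the data numeral `N`: slots `slots·i … slots·i + slots − 1`;
slot `t` of `I` is `offset + 2^ob · length` in bits `[(ob+lb)·t, (ob+lb)·(t+1))`; a record is `m + 2^mb · (enc_m z)`. [folklore] -/
def certsOfN (slots ob lb mb I N i : ℕ) : List (ℕ × ℕ) :=
  (List.range slots).filterMap fun j =>
    let e := bitsN I ((ob + lb) * (slots * i + j)) (ob + lb)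
    let o := e % 2 ^ ob
    let len := e >>> ob
    if len = 0 then none else
      let r := bitsN N o len
      some (r % 2 ^ mb, r >>> mb)

/-- A window of `X`-data against a certificate TABLE (`I`, `N`): `chunkChkG` on the decoded certificates. [folklore] -/
def chunkChkN (q K X : ℕ) (W : List ℕ) (Fs : List (List ℕ)) (slots ob lb mb I N : ℕ) : Bool :=
  chunkChkG q K X W Fs ((List.range Fs.length).map (certsOfN slots ob lb mb I N))

section Sound

variable {q : ℕ} [NeZero q]

/-- **Soundness of a window certified by a table** (semantic shape of `hkill`, `ThreeSetZpCells4Core`). [folklore] -/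
theorem chunkChkN_sound {K X e slots ob lb mb I N : ℕ} {W : List ℕ} {Fs : List (List ℕ)}
    (h : chunkChkN q K X W Fs slots ob lb mb I N = true) :
    ∀ F ∈ Fs, ∀ (G : ZMod q → ℕ) (s : ZMod q), (∀ u, G u ≤ e) →
      ¬ ∀ τ : ZMod q, (∑ u : ZMod q, lineMat3 (vecFn W) (vecFn F) τ u * G u) + (if s = τ then 1 else 0) = K :=
  chunkChkG_sound h

end Sound

end LineInv

end Summit.MatrixMultiplication.OmegaCensus
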